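import Literature.NumberTheory.Automorphic.UnitaryThreeSingularUnipotentClasses   -- ★ `n(t)`, `d(z)`, `u(x,z)` membership (F0P3a-p08 (g16))
import Literature.NumberTheory.Automorphic.UnitaryTwoUnipotentClasses            -- ★ `B₀_two_apply`, `n(t)` on `K²` (F0P3a-p08 (g17))
import HarnessLib

/-!
# Centralisers of the singular unipotent `n(t)` in `U(3)` and of `n(t)` in `U(1,1)`: `G_{n(t)} = S·N` (Rogawski 1990, §3.9 p. 32)

Topic `NumberTheory/Automorphic`; namespace `Literature.NumberTheory.Automorphic.UnitaryGroup`.  THEOREMS ONLY (no definition, no instance, no notation,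
no named fact, no `sorry`).  Cell `pub/hodgecm-mathlib` (D-0151), crux H413 = `stmt-HodgeConjecture-24833`, line «N6nsGerm», residue `stub_N6nsS3id` (transfer at the
identity = Shalika germs on `G′_v = U(3)` and `H_v = U(1,1) × U(1)`; CENSUS «S3» v2 (M1)∕(M2), architect A-p16 (g28)).  Sequel of ★ `UnitaryThreeSingularUnipotentClasses`,
★ `UnitaryThreeUnipotentConjugacy`, ★ `UnitaryTwoUnipotentClasses` (the unipotent-class INDEX SETS): here the CENTRALISERS of the singular classes, i.e. the groups
`G_u` over which the orbital integrals `∫_{G_u∖G} φ(g⁻¹ u g)` at the singular unipotent orbits are taken ([Rogawski1990] §3.9: «If `u = n(t)`, then `G_u = S·N` where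
`S = {m ∈ M : α₃(m) = 1}`»; used in Prop. 8.3.1's `μ(γ₀)⁻¹ f^H(γ₀)` normalisation).  Written by F0P3a-p08 (g17).  HONEST LABEL: HC_CM is proved only modulo the printed
citations (the 2 remaining named inputs hLiu418, h413) until rung 0 closes; elementary matrix algebra only.

SETTING (★ `UnitaryAntidiagFrames`): any field `K`, ring endomorphism `σ` (involution where stated), `J₀ = (StdForm.antidiagonal N).over K`, `U(σ, J₀) =` ★ `unitaryGroupOfForm σ J₀`,
`n(t) = 1 + t·E₀₂` (`N = 3`) resp. `1 + t·E₀₁` (`N = 2`), `M` = the diagonal torus, `N` = upper unitriangular.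
* §1 (`N = 3`, any `g ∈ M₃(K)`, `t ≠ 0`) **`mul_cornerUnipotent_eq_cornerUnipotent_mul_iff`** — `g·n(t) = n(t)·g ↔ g₁₀ = g₂₀ = g₂₁ = 0 ∧ g₀₀ = g₂₂` (the centraliser of
  `E₀₂` in `M₃(K)`: upper triangular with equal corner diagonal entries).
* §2 (`N = 3`, `σ² = 1`) **`exists_coe_eq_torus_mul_upperUnipotent_of_commute`** — «`G_u = S·N`»: a `g ∈ U(σ, J₀)` commuting with `n(t)` (`t ≠ 0`) is
  `diag(α, β, α)·u(x, z)` with `σα·α = 1`, `σβ·β = 1` (i.e. `diag(α, β, α) ∈ S = {m ∈ M : α₃(m) = 1}`, a unitary element by `diagonal_mem_unitaryGroupOfForm_three_iff`) and `u(x, z) ∈ N ∩ U`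
  (`z + σz + xσx = 0`); conversely `torus_mul_upperUnipotent_commute_cornerUnipotent` — every such product commutes with `n(t)`.
* §3 (`N = 2`) **`mul_lineUnipotent_eq_lineUnipotent_mul_iff`** (`g·n(t) = n(t)·g ↔ g₁₀ = 0 ∧ g₀₀ = g₁₁`) and **`exists_coe_eq_scalar_mul_lineUnipotent_of_commute`** —
  in `U(Φ₂)` the centraliser of `n(t)` (`t ≠ 0`) is `Z·N = {α·n(s) : σα·α = 1, σs + s = 0}`.

## References
* [Rogawski1990] J. D. Rogawski, *Automorphic Representations of Unitary Groups in Three Variables*, Ann. of Math. Stud. 123 (1990): §1.10 p. 9 (`M`, `N`, `n(t)`),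
  §3.9 p. 32 («`G_u = S·N`»), Prop. 8.3.1 p. 122 (where `μ(γ₀)` = measure of the centraliser enters).
* [Mok2014] C. P. Mok, *Endoscopic classification of representations of quasi-split unitary groups*, Mem. AMS 235 (2015): §1 Notation p. 5 (the form `J_N`).
-/

set_option autoImplicit false

open Matrix

namespace Literature.NumberTheory.Automorphic.UnitaryGroup

open Literature.NumberTheory.Automorphic.HermitianLattice

variable {K : Type*} [Field K] (σ : K →+* K)

/-! ## §1 The centraliser of `n(t)` in `M₃(K)` -/

/-- Entries of `g·n(t)`: columns `0, 1` of `g`, and column `2` is `t·(column 0) + (column 2)`. [cite: Rogawski1990, §1.10 p. 9] -/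
theorem mul_cornerUnipotent_apply (g : Matrix (Fin 3) (Fin 3) K) (t : K) (i : Fin 3) :
    (g * !![1, 0, t; 0, 1, 0; 0, 0, 1]) i 0 = g i 0 ∧ (g * !![1, 0, t; 0, 1, 0; 0, 0, 1]) i 1 = g i 1 ∧
      (g * !![1, 0, t; 0, 1, 0; 0, 0, 1]) i 2 = g i 0 * t + g i 2 := by
  refine ⟨?_, ?_, ?_⟩ <;> simp [Matrix.mul_apply, Fin.sum_univ_three]

/-- Entries of `n(t)·g`: rows `1, 2` of `g`, and row `0` is `(row 0) + t·(row 2)`. [cite: Rogawski1990, §1.10 p. 9] -/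
theorem cornerUnipotent_mul_apply (g : Matrix (Fin 3) (Fin 3) K) (t : K) (j : Fin 3) :
    (!![1, 0, t; 0, 1, 0; 0, 0, 1] * g) 0 j = g 0 j + t * g 2 j ∧ (!![1, 0, t; 0, 1, 0; 0, 0, 1] * g) 1 j = g 1 j ∧
      (!![1, 0, t; 0, 1, 0; 0, 0, 1] * g) 2 j = g 2 j := by
  refine ⟨?_, ?_, ?_⟩ <;> simp [Matrix.mul_apply, Fin.sum_univ_three]

/-- **THE CENTRALISER OF `n(t)` (`t ≠ 0`) IN `M₃(K)`**: `g·n(t) = n(t)·g` iff `g` is upper triangular with `g₀₀ = g₂₂` (i.e. `g` commutes with `E₀₂`).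
[cite: Rogawski1990, §3.9 p. 32] -/
theorem mul_cornerUnipotent_eq_cornerUnipotent_mul_iff {t : K} (ht : t ≠ 0) (g : Matrix (Fin 3) (Fin 3) K) :
    g * !![1, 0, t; 0, 1, 0; 0, 0, 1] = !![1, 0, t; 0, 1, 0; 0, 0, 1] * g ↔ g 1 0 = 0 ∧ g 2 0 = 0 ∧ g 2 1 = 0 ∧ g 0 0 = g 2 2 := by
  constructor
  · intro h
    have e := fun i j => congr_fun (congr_fun h i) j
    have h12 := e 1 2
    have h22 := e 2 2
    have h01 := e 0 1
    have h02 := e 0 2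
    rw [(mul_cornerUnipotent_apply g t 1).2.2, (cornerUnipotent_mul_apply g t 2).2.1] at h12
    rw [(mul_cornerUnipotent_apply g t 2).2.2, (cornerUnipotent_mul_apply g t 2).2.2] at h22
    rw [(mul_cornerUnipotent_apply g t 0).2.1, (cornerUnipotent_mul_apply g t 1).1] at h01
    rw [(mul_cornerUnipotent_apply g t 0).2.2, (cornerUnipotent_mul_apply g t 2).1] at h02
    -- `h12 : g₁₀ t + g₁₂ = g₁₂`, `h22 : g₂₀ t + g₂₂ = g₂₂`, `h01 : g₀₁ = g₀₁ + t g₂₁`, `h02 : g₀₀ t + g₀₂ = g₀₂ + t g₂₂`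
    have h10 : g 1 0 = 0 := by
      have : g 1 0 * t = 0 := by linear_combination h12
      exact (mul_eq_zero.1 this).resolve_right ht
    have h20 : g 2 0 = 0 := by
      have : g 2 0 * t = 0 := by linear_combination h22
      exact (mul_eq_zero.1 this).resolve_right ht
    have h21 : g 2 1 = 0 := by
      have : g 2 1 * t = 0 := by linear_combination -h01
      exact (mul_eq_zero.1 this).resolve_right ht
    have h00 : g 0 0 = g 2 2 := by
      have : (g 0 0 - g 2 2) * t = 0 := by linear_combination h02
      exact sub_eq_zero.1 ((mul_eq_zero.1 this).resolve_right ht)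
    exact ⟨h10, h20, h21, h00⟩
  · rintro ⟨h10, h20, h21, h00⟩
    ext i j
    fin_cases i <;> fin_cases j <;> (simp [Matrix.mul_apply, Fin.sum_univ_three, h10, h20, h21, h00]; try ring)

/-! ## §2 `G_{n(t)} = S·N` in `U(σ, J₀)` (`N = 3`) -/

/-- The diagonal torus `M ∩ U(σ, J₀)`: `diag(α, β, γ) ∈ U(σ, J₀)` iff `σα·γ = 1`, `σβ·β = 1`, `σγ·α = 1` (for `B₀(d x, d y) = σα γ·σx₀y₂ + σβ β·σx₁y₁ + σγ α·σx₂y₀`).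
[cite: Rogawski1990, §1.10 p. 9] -/
theorem diagonal_mem_unitaryGroupOfForm_three_iff {α β γ : K} {d : GL (Fin 3) K} (hd : (d : Matrix (Fin 3) (Fin 3) K) = Matrix.diagonal ![α, β, γ]) :
    d ∈ unitaryGroupOfForm σ ((StdForm.antidiagonal 3).over K) ↔ σ α * γ = 1 ∧ σ β * β = 1 ∧ σ γ * α = 1 := by
  rw [mem_unitaryGroupOfForm_antidiagonal_iff, hd]
  have e0 : (![α, β, γ] : Fin 3 → K) 0 = α := rfl
  have e1 : (![α, β, γ] : Fin 3 → K) 1 = β := rfl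
  have e2 : (![α, β, γ] : Fin 3 → K) 2 = γ := rfl
  have key : ∀ x y : Fin 3 → K, B₀ σ 3 (Matrix.diagonal ![α, β, γ] *ᵥ x) (Matrix.diagonal ![α, β, γ] *ᵥ y) =
      σ α * γ * (σ (x 0) * y 2) + σ β * β * (σ (x 1) * y 1) + σ γ * α * (σ (x 2) * y 0) := by
    intro x y
    rw [B₀_three_apply]
    simp only [Matrix.mulVec_diagonal, e0, e1, e2, map_mul]
    ring
  constructor
  · intro h
    have h02 := h (Pi.single 0 1) (Pi.single 2 1)
    have h11 := h (Pi.single 1 1) (Pi.single 1 1)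
    have h20 := h (Pi.single 2 1) (Pi.single 0 1)
    rw [key, B₀_three_apply] at h02 h11 h20
    simp at h02 h11 h20
    exact ⟨h02, h11, h20⟩
  · rintro ⟨h1, h2, h3⟩ x y
    rw [key, B₀_three_apply, h1, h2, h3, one_mul, one_mul, one_mul]

/-- The element `diag(α, β, α)` of `S = {m ∈ M : α₃(m) = 1}` as a unit (`α, β ≠ 0`), with inverse `diag(α⁻¹, β⁻¹, α⁻¹)`. [cite: Rogawski1990, §3.9 p. 32] -/
theorem exists_units_coe_eq_torusS {α β : K} (hα : α ≠ 0) (hβ : β ≠ 0) :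
    ∃ m : GL (Fin 3) K, (m : Matrix (Fin 3) (Fin 3) K) = Matrix.diagonal ![α, β, α] ∧
      ((m⁻¹ : GL (Fin 3) K) : Matrix (Fin 3) (Fin 3) K) = Matrix.diagonal ![α⁻¹, β⁻¹, α⁻¹] := by
  have h1 : Matrix.diagonal ![α, β, α] * Matrix.diagonal ![α⁻¹, β⁻¹, α⁻¹] = 1 := by
    rw [Matrix.diagonal_mul_diagonal, ← Matrix.diagonal_one]
    congr 1; funext i; fin_cases i <;> simp [mul_inv_cancel₀ hα, mul_inv_cancel₀ hβ]
  have h2 : Matrix.diagonal ![α⁻¹, β⁻¹, α⁻¹] * Matrix.diagonal ![α, β, α] = 1 := by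
    rw [Matrix.diagonal_mul_diagonal, ← Matrix.diagonal_one]
    congr 1; funext i; fin_cases i <;> simp [inv_mul_cancel₀ hα, inv_mul_cancel₀ hβ]
  exact ⟨⟨_, _, h1, h2⟩, rfl, rfl⟩

/-- **«`G_u = S·N`»** ([Rogawski1990] §3.9, `u = n(t)`, `t ≠ 0`, `σ` an involution): a `g ∈ U(σ, J₀)` commuting with `n(t)` factors as `g = m·n` with
`m = diag(α, β, α) ∈ S` (`σα·α = 1`, `σβ·β = 1`, so `m ∈ U(σ, J₀)`) and `n = u(x, z) = (1, x, z; 0, 1, −σx; 0, 0, 1) ∈ N ∩ U(σ, J₀)` (`z + σz + xσx = 0`).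
PROOF: §1 makes `g` upper triangular with diagonal `(α, β, α)`; unitarity (`B₀(g e₀, g e₂) = 1`, `B₀(g e₁, g e₁) = 1`) gives the norm conditions; `m⁻¹ g` is then an
upper unitriangular element of `U(σ, J₀)`, hence `u(x, z)` by ★ `mem_unitaryGroupOfForm_iff_of_coe_eq_upperUnipotent`. [cite: Rogawski1990, §3.9 p. 32] -/
theorem exists_coe_eq_torus_mul_upperUnipotent_of_commute (hσ : ∀ z : K, σ (σ z) = z) {t : K} (ht : t ≠ 0) {u g : GL (Fin 3) K}
    (hu : (u : Matrix (Fin 3) (Fin 3) K) = !![1, 0, t; 0, 1, 0; 0, 0, 1]) (hg : g ∈ unitaryGroupOfForm σ ((StdForm.antidiagonal 3).over K))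
    (hcomm : g * u = u * g) :
    ∃ α β x z : K, σ α * α = 1 ∧ σ β * β = 1 ∧ z + σ z + x * σ x = 0 ∧
      (g : Matrix (Fin 3) (Fin 3) K) = Matrix.diagonal ![α, β, α] * !![1, x, z; 0, 1, -σ x; 0, 0, 1] := by
  set G : Matrix (Fin 3) (Fin 3) K := (g : Matrix (Fin 3) (Fin 3) K) with hG
  have hcomm' : G * !![1, 0, t; 0, 1, 0; 0, 0, 1] = !![1, 0, t; 0, 1, 0; 0, 0, 1] * G := by
    rw [hG, ← hu, ← Units.val_mul, hcomm, Units.val_mul]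
  obtain ⟨h10, h20, h21, h00⟩ := (mul_cornerUnipotent_eq_cornerUnipotent_mul_iff ht G).1 hcomm'
  have hinv := (mem_unitaryGroupOfForm_antidiagonal_iff (σ := σ) (N := 3) g).1 hg
  have hGe : ∀ i j, (G *ᵥ Pi.single j 1) i = G i j := fun i j => by rw [Matrix.mulVec_single_one]; rfl
  -- the norm conditions on the diagonal
  have hα : σ (G 0 0) * G 0 0 = 1 := by
    have h := hinv (Pi.single 0 1) (Pi.single 2 1)
    rw [B₀_three_apply, B₀_three_apply, hGe, hGe, hGe, hGe, hGe, hGe, h10, h20, ← h00] at h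
    simpa using h
  have hβ : σ (G 1 1) * G 1 1 = 1 := by
    have h := hinv (Pi.single 1 1) (Pi.single 1 1)
    rw [B₀_three_apply, B₀_three_apply, hGe, hGe, hGe, h21] at h
    simpa using h
  have hα0 : G 0 0 ≠ 0 := right_ne_zero_of_mul_eq_one hα
  have hβ0 : G 1 1 ≠ 0 := right_ne_zero_of_mul_eq_one hβ
  -- `n := m⁻¹ g` is upper unitriangular and unitary
  obtain ⟨m, hm, hm'⟩ := exists_units_coe_eq_torusS (K := K) hα0 hβ0
  have hmU : m ∈ unitaryGroupOfForm σ ((StdForm.antidiagonal 3).over K) := by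
    refine (diagonal_mem_unitaryGroupOfForm_three_iff σ hm).2 ⟨hα, hβ, hα⟩
  have hn : ((m⁻¹ * g : GL (Fin 3) K) : Matrix (Fin 3) (Fin 3) K) = !![1, (G 0 0)⁻¹ * G 0 1, (G 0 0)⁻¹ * G 0 2; 0, 1, (G 1 1)⁻¹ * G 1 2; 0, 0, 1] := by
    rw [Units.val_mul, hm', ← hG]
    ext i j
    fin_cases i <;> fin_cases j <;> simp [Matrix.diagonal_mul, h10, h20, h21, ← h00, hα0, hβ0]
  have hnU : m⁻¹ * g ∈ unitaryGroupOfForm σ ((StdForm.antidiagonal 3).over K) := mul_mem (inv_mem hmU) hg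
  obtain ⟨hc, hz⟩ := (mem_unitaryGroupOfForm_iff_of_coe_eq_upperUnipotent σ hσ hn).1 hnU
  refine ⟨G 0 0, G 1 1, (G 0 0)⁻¹ * G 0 1, (G 0 0)⁻¹ * G 0 2, hα, hβ, hz, ?_⟩
  calc G = (m : Matrix (Fin 3) (Fin 3) K) * ((m⁻¹ * g : GL (Fin 3) K) : Matrix (Fin 3) (Fin 3) K) := by
        rw [Units.val_mul, ← mul_assoc, Units.mul_inv, one_mul]
    _ = Matrix.diagonal ![G 0 0, G 1 1, G 0 0] * !![1, (G 0 0)⁻¹ * G 0 1, (G 0 0)⁻¹ * G 0 2; 0, 1, -σ ((G 0 0)⁻¹ * G 0 1); 0, 0, 1] := by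
        rw [hm, hn, ← hc]

/-- Conversely, every `diag(α, β, α)·(1, x, z; 0, 1, c; 0, 0, 1)` commutes with `n(t)` (no unitarity needed). [cite: Rogawski1990, §3.9 p. 32] -/
theorem torus_mul_upperUnipotent_commute_cornerUnipotent (α β x z c t : K) :
    Matrix.diagonal ![α, β, α] * !![1, x, z; 0, 1, c; 0, 0, 1] * !![1, 0, t; 0, 1, 0; 0, 0, 1] =
      !![1, 0, t; 0, 1, 0; 0, 0, 1] * (Matrix.diagonal ![α, β, α] * !![1, x, z; 0, 1, c; 0, 0, 1]) := by
  ext i j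
  fin_cases i <;> fin_cases j <;> (simp [Matrix.mul_apply, Matrix.diagonal, Fin.sum_univ_three]; try ring)

/-! ## §3 The centraliser of `n(t)` in `U(Φ₂)`: `Z·N` -/

/-- Entries of `g·n(t)` and `n(t)·g` on `K²`. [cite: Rogawski1990, §1.10 p. 9] -/
theorem mul_lineUnipotent_apply (g : Matrix (Fin 2) (Fin 2) K) (t : K) (i : Fin 2) :
    (g * !![1, t; 0, 1]) i 0 = g i 0 ∧ (g * !![1, t; 0, 1]) i 1 = g i 0 * t + g i 1 ∧
      (!![1, t; 0, 1] * g) 0 i = g 0 i + t * g 1 i ∧ (!![1, t; 0, 1] * g) 1 i = g 1 i := by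
  refine ⟨?_, ?_, ?_, ?_⟩ <;> simp [Matrix.mul_apply, Fin.sum_univ_two]

/-- **The centraliser of `n(t) = 1 + t·E₀₁` (`t ≠ 0`) in `M₂(K)`**: `g·n(t) = n(t)·g ↔ g₁₀ = 0 ∧ g₀₀ = g₁₁`. [cite: Rogawski1990, §3.9 p. 32] -/
theorem mul_lineUnipotent_eq_lineUnipotent_mul_iff {t : K} (ht : t ≠ 0) (g : Matrix (Fin 2) (Fin 2) K) :
    g * !![1, t; 0, 1] = !![1, t; 0, 1] * g ↔ g 1 0 = 0 ∧ g 0 0 = g 1 1 := by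
  constructor
  · intro h
    have h11 := congr_fun (congr_fun h 1) 1
    have h01 := congr_fun (congr_fun h 0) 1
    rw [(mul_lineUnipotent_apply g t 1).2.1, (mul_lineUnipotent_apply g t 1).2.2.2] at h11
    rw [(mul_lineUnipotent_apply g t 0).2.1, (mul_lineUnipotent_apply g t 1).2.2.1] at h01
    -- `h11 : g₁₀ t + g₁₁ = g₁₁`, `h01 : g₀₀ t + g₀₁ = g₀₁ + t g₁₁`
    have h10 : g 1 0 = 0 := by
      have : g 1 0 * t = 0 := by linear_combination h11
      exact (mul_eq_zero.1 this).resolve_right ht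
    have h00 : g 0 0 = g 1 1 := by
      have : (g 0 0 - g 1 1) * t = 0 := by linear_combination h01
      exact sub_eq_zero.1 ((mul_eq_zero.1 this).resolve_right ht)
    exact ⟨h10, h00⟩
  · rintro ⟨h10, h00⟩
    ext i j
    fin_cases i <;> fin_cases j <;> (simp [Matrix.mul_apply, Fin.sum_univ_two, h10, h00]; try ring)

/-- **The centraliser of `n(t)` in `U(Φ₂)` is `Z·N`** (`t ≠ 0`): a `g ∈ U(σ, J₀)` (`N = 2`) commuting with `n(t)` is `α·n(s)` with `σα·α = 1` (a central element of
`U(Φ₂)`) and `σs + s = 0` (`n(s) ∈ N ∩ U`). [cite: Rogawski1990, §3.9 p. 32] -/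
theorem exists_coe_eq_scalar_mul_lineUnipotent_of_commute {t : K} (ht : t ≠ 0) {u g : GL (Fin 2) K}
    (hu : (u : Matrix (Fin 2) (Fin 2) K) = !![1, t; 0, 1]) (hg : g ∈ unitaryGroupOfForm σ ((StdForm.antidiagonal 2).over K)) (hcomm : g * u = u * g) :
    ∃ α s : K, σ α * α = 1 ∧ σ s + s = 0 ∧ (g : Matrix (Fin 2) (Fin 2) K) = α • !![1, s; 0, 1] := by
  set G : Matrix (Fin 2) (Fin 2) K := (g : Matrix (Fin 2) (Fin 2) K) with hG
  have hcomm' : G * !![1, t; 0, 1] = !![1, t; 0, 1] * G := by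
    rw [hG, ← hu, ← Units.val_mul, hcomm, Units.val_mul]
  obtain ⟨h10, h00⟩ := (mul_lineUnipotent_eq_lineUnipotent_mul_iff ht G).1 hcomm'
  have hinv := (mem_unitaryGroupOfForm_antidiagonal_iff (σ := σ) (N := 2) g).1 hg
  have hGe : ∀ i j, (G *ᵥ Pi.single j 1) i = G i j := fun i j => by rw [Matrix.mulVec_single_one]; rfl
  have hα : σ (G 0 0) * G 0 0 = 1 := by
    have h := hinv (Pi.single 0 1) (Pi.single 1 1)
    rw [B₀_two_apply, B₀_two_apply, hGe, hGe, hGe, hGe, h10, ← h00] at h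
    simpa using h
  have hα0 : G 0 0 ≠ 0 := right_ne_zero_of_mul_eq_one hα
  have h01 : σ (G 0 1) * G 0 0 + σ (G 0 0) * G 0 1 = 0 := by
    have h := hinv (Pi.single 1 1) (Pi.single 1 1)
    rw [B₀_two_apply, B₀_two_apply, hGe, hGe, ← h00] at h
    simpa using h
  refine ⟨G 0 0, (G 0 0)⁻¹ * G 0 1, hα, ?_, ?_⟩
  · -- `σs + s = 0` for `s = α⁻¹ g₀₁`: `(σα)⁻¹ = α` and `α⁻¹ = σα` since `σα·α = 1`
    rw [map_mul, map_inv₀, inv_eq_of_mul_eq_one_right hα, inv_eq_of_mul_eq_one_left hα]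
    linear_combination h01
  · ext i j
    fin_cases i <;> fin_cases j <;> simp [h10, ← h00, hα0]

end Literature.NumberTheory.Automorphic.UnitaryGroup
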